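/-
Copyright (c) 2026 the pub-hodgecm-mathlib formalisation cell (harness21).  Prover seat hodgecm-mathlib-F0P3a-p01 (g16): road «S3-ram» (LEAD F0P3a-plan (g12); architect
A-p16 (g31) 23:50:49Z «JUNCTION = yours»), junction brick J8-iso «THE κ-SUM ALGEBRA, ISOCELES-A CONFIGURATION»; 2026-09-02.
-/
import Mathlib
import HarnessLib

/-!
# The ramified type-(1) `κ`-orbital integral: the κ-signed shell sums of the ISOCELES configuration (`N₁ = N₂ < N`) collapse to the same five brackets `X̃(n)`
# (Rogawski 1990 §4.9; Kottwitz 1986 §3)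

Topic `NumberTheory/Rogawski1990`; namespace `Literature.NumberTheory.Rogawski1990`.  THEOREMS ONLY (no definition, no instance, no notation, no named fact, no `sorry`); kernel
lane `--supports stmt-HodgeConjecture-24833`; Mathlib only.  Cell `pub/hodgecm-mathlib` (D-0151), crux H413; road «S3-ram», P-1-ram organ A′ (ii) (a2), JUNCTION brick **J8-iso**
(plan `STATUS 23:57:42Z`; companion of J8-eq `DepthZeroKappaTransferTypeOneRamifiedKappaSumEquilateral`).  PURE ALGEBRA over `ℚ`.

THE MATHEMATICS.  Isoceles-A configuration `(N₁, N₂, N) = (2m+3, 2m+3, 2(m+1+s)+1)` (root depth `d₀ = 2m+3`, axis radius `s`; `m, s ≥ 0` — `s = 0` is the equilateral case).  By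
B-p14 (g39)'s CENSUS-G6 (ba7b3992 §0) and the engine ★ G5 ED. 2 (`strataVec_cone_eq_of_localLaw_axis`, `strataVec_total_eq_of_localLaw_axis_of_root`): the two AXIS literals
(`κ = +1`) total `2e₄ + 2q·(T^{BIG}_{s−1} + T^{SMALL}_{s−1}) + 2(q−1)q·S(P^{c_R}_m)` with the axis recursion `T_{j+1} = e₄ + q·T_j + (q−1)q·S(P^{c_R}_m)`,
`T^{BIG}_0 + T^{SMALL}_0 = 2e₄ + 2q·S(E_{m+1}) + (q−2)q·S(P^{c_R}_m) + q²·S(P^{−c_R}_m)`; the two BARE literals (`κ = −1`) total `2e₄ + 2(q+1)q·S(P^{−c_R}_m)`.  Unrolling, the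
coefficients of `S(P^{c_R}_m)` and `S(P^{−c_R}_m)` in the κ-signed sum come out EQUAL (`2q^{s+2} − 2q² − 2q` each), so only `S(P⁺_m) + S(P⁻_m)` enters, and
  `Σ_b κ_b n_{b,·} = 4q^{s+1}·S(E_{m+1}) + (2q^{s+2} − 2q² − 2q)·(S(P⁺_m) + S(P⁻_m)) + 4q(Σ_{i<s} qⁱ)·e₄`.
THIS FILE: that vector equals `q^{2m+3}·X̃(m+1+s)`, `X̃(n) = (4qⁿ, 4qⁿ⁻¹, 2(qⁿ−q−1)∕q², 2(qⁿ−q−1)∕q², 4(qⁿ−1)∕((q−1)q²))`, componentwise over `ℚ` (`q ≥ 2`) — with the exponent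
`2m+3 = (N₁+N₂)∕2` and `n = m+1+s = (N−1)∕2`, exactly the junction head's normalisation `q^{(N₁+N₂)∕2}·X̃((N−1)∕2)`; at `s = 0` it is the equilateral identity ★ `kappaSum_equilateral_eq`.
Proof: the three geometric sums in closed form (`(q−1)Σ_{i<m}qⁱ = q^m − 1`, `(q²−1)Σ_{i<m}q^{2i} = q^{2m} − 1`, `(q−1)Σ_{i<s}qⁱ = q^s − 1`), then `field_simp; ring` per slot.
HONEST LABEL: HC_CM is proved only modulo the 2 remaining named inputs (hLiu418 24832, h413 24833) until rung 0 closes; nothing printed is asserted here (finite geometric sums).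

## References
* [Rogawski1990] J. D. Rogawski, *Automorphic Representations of Unitary Groups in Three Variables*, Ann. of Math. Stud. 123 (1990), §4.9 Prop. 4.9.1 (a) p. 55.
* [Kottwitz1986] R. E. Kottwitz, *Base change for unit elements of Hecke algebras*, Compositio Math. 60 (1986), §3.
-/

set_option autoImplicit false

open Finset

namespace Literature.NumberTheory.Rogawski1990

/-- `Σ_{i<m} q^{2i} · (q² − 1) = q^{2m} − 1` over `ℚ`. [cite: Kottwitz1986, §3] -/
theorem geom_sum_sq_mul_rat (q : ℚ) (m : ℕ) : (∑ i ∈ range m, q ^ (2 * i)) * (q ^ 2 - 1) = q ^ (2 * m) - 1 := by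
  simp_rw [pow_mul]
  exact geom_sum_mul (q ^ 2) m

/-- **THE ISOCELES-A κ-SUM IDENTITY** (and, at `s = 0`, the equilateral one): for each of the five strata,
`4q^{s+1}·S(E_{m+1})_j + (2q^{s+2} − 2q² − 2q)·(S(P⁺_m)+S(P⁻_m))_j + 4q(Σ_{i<s}qⁱ)·e₄_j = q^{2m+3}·X̃_j(m+1+s)` over `ℚ` (`2 ≤ q`), with the ★ closed forms
`S(E_{m+1}) = (q^{3m+3}, q^{3m+2}, C(q,2)q^{2m}Σ_{i<m}qⁱ, same, Σ_{i≤m}q^{2i} + Σ_{i<m}q^{2m+1+i})`, `S(P⁺_m) + S(P⁻_m) = (0, 0, q^{2m}, q^{2m}, 2Σ_{i<m}q^{2i})`.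
[cite: Rogawski1990, §4.9 Prop. 4.9.1 (a) p. 55] [cite: Kottwitz1986, §3] -/
theorem kappaSum_isoceles_eq (q m s : ℕ) (hq : 2 ≤ q) (j : Fin 5) :
    4 * (q : ℚ) ^ (s + 1) * (((![q ^ (3 * m + 3), q ^ (3 * m + 2), q.choose 2 * q ^ (2 * m) * ∑ i ∈ range m, q ^ i, q.choose 2 * q ^ (2 * m) * ∑ i ∈ range m, q ^ i,
          ∑ i ∈ range (m + 1), q ^ (2 * i) + ∑ i ∈ range m, q ^ (2 * m + 1 + i)] : Fin 5 → ℕ) j : ℕ) : ℚ) +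
        (2 * (q : ℚ) ^ (s + 2) - 2 * (q : ℚ) ^ 2 - 2 * q) * (((![0, 0, q ^ (2 * m), q ^ (2 * m), 2 * ∑ i ∈ range m, q ^ (2 * i)] : Fin 5 → ℕ) j : ℕ) : ℚ) +
        4 * (q : ℚ) * (∑ i ∈ range s, (q : ℚ) ^ i) * (((![0, 0, 0, 0, 1] : Fin 5 → ℕ) j : ℕ) : ℚ) =
      (q : ℚ) ^ (2 * m + 3) *
        (![4 * (q : ℚ) ^ (m + 1 + s), 4 * (q : ℚ) ^ (m + 1 + s - 1), (2 * ((q : ℚ) ^ (m + 1 + s) - q - 1)) / (q : ℚ) ^ 2, (2 * ((q : ℚ) ^ (m + 1 + s) - q - 1)) / (q : ℚ) ^ 2,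
            (4 * ((q : ℚ) ^ (m + 1 + s) - 1)) / (((q : ℚ) - 1) * (q : ℚ) ^ 2)] : Fin 5 → ℚ) j := by
  have hq0 : (q : ℚ) ≠ 0 := by exact_mod_cast (show q ≠ 0 by omega)
  have hq1 : (q : ℚ) - 1 ≠ 0 := sub_ne_zero.2 (by exact_mod_cast (show q ≠ 1 by omega))
  have hq2 : (q : ℚ) ^ 2 - 1 ≠ 0 := by
    have h : (1 : ℚ) < (q : ℚ) ^ 2 := by
      have hq' : (2 : ℚ) ≤ q := by exact_mod_cast hq
      nlinarith
    exact sub_ne_zero.2 (ne_of_gt h)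
  have hS : (∑ i ∈ range m, (q : ℚ) ^ i) = ((q : ℚ) ^ m - 1) / ((q : ℚ) - 1) := by
    rw [eq_div_iff hq1]; exact geom_sum_mul _ m
  have hS2 : (∑ i ∈ range m, (q : ℚ) ^ (2 * i)) = ((q : ℚ) ^ (2 * m) - 1) / ((q : ℚ) ^ 2 - 1) := by
    rw [eq_div_iff hq2]; exact geom_sum_sq_mul_rat _ m
  have hT : (∑ i ∈ range s, (q : ℚ) ^ i) = ((q : ℚ) ^ s - 1) / ((q : ℚ) - 1) := by
    rw [eq_div_iff hq1]; exact geom_sum_mul _ s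
  have hC : ((q.choose 2 : ℕ) : ℚ) = (q : ℚ) * ((q : ℚ) - 1) / 2 := Nat.cast_choose_two ℚ q
  have hsum1 : ((∑ i ∈ range m, q ^ i : ℕ) : ℚ) = ∑ i ∈ range m, (q : ℚ) ^ i := by push_cast; rfl
  have hsum2 : ((∑ i ∈ range m, q ^ (2 * i) : ℕ) : ℚ) = ∑ i ∈ range m, (q : ℚ) ^ (2 * i) := by push_cast; rfl
  have hsum3 : ((∑ i ∈ range (m + 1), q ^ (2 * i) : ℕ) : ℚ) = ∑ i ∈ range m, (q : ℚ) ^ (2 * i) + (q : ℚ) ^ (2 * m) := by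
    push_cast; rw [Finset.sum_range_succ]
  have hsum4 : ((∑ i ∈ range m, q ^ (2 * m + 1 + i) : ℕ) : ℚ) = (q : ℚ) ^ (2 * m + 1) * ∑ i ∈ range m, (q : ℚ) ^ i := by
    push_cast; rw [Finset.mul_sum]; exact Finset.sum_congr rfl (fun i _ => by rw [pow_add])
  have hpow2m : (q : ℚ) ^ (2 * m) = ((q : ℚ) ^ m) ^ 2 := by rw [← pow_mul, mul_comm]
  have hn1 : m + 1 + s - 1 = m + s := by omega
  fin_cases j
  · simp; ring
  · simp [hn1]; ring
  · simp only [Fin.reduceFinMk, Matrix.cons_val, Nat.cast_mul, Nat.cast_pow, hC, hsum1, hS, hpow2m]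
    field_simp
    ring
  · simp only [Fin.reduceFinMk, Matrix.cons_val, Nat.cast_mul, Nat.cast_pow, hC, hsum1, hS, hpow2m]
    field_simp
    ring
  · simp only [Fin.reduceFinMk, Matrix.cons_val, Nat.cast_mul, Nat.cast_add, Nat.cast_ofNat, Nat.cast_one, hsum2, hsum3, hsum4, hS, hS2, hT, hpow2m]
    field_simp
    ring

/-! ## (ED. 2, F0P3a-p02 (g17)) §2 The POOLING behind the isoceles identities, and the ISOCELES-B configuration `N₁ ≠ N₂`

Append-only over the ★ bytes above (F0P3a-p01 (g16)).  WHAT IS ADDED.  (i) The census rows (B-p14 (g39) `CENSUS-G6-axis` §0) per axis vertex — root ∕ interior: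
`(q−1)·q` off-axis grandchildren of label `P^{c_R}_m`; boundary (`2q^s` vertices): BIG `2q` of `E_{m+1}`, `((q−3)∕2)q` of `P^{c_R}_m`, `((q−1)∕2)q` of `P^{−c_R}_m`, SMALL
`((q−1)∕2)q` of `P^{c_R}_m`, `((q+1)∕2)q` of `P^{−c_R}_m`; bare literal: `(q+1)q` of ONE class, and that class is `−c_R` (the root datum `Q = −2Ā·d̄_u·x̄_u²` resp.
`2Ā·d̄_α·x̄_α²` flips class exactly between the axis pair and the bare pair) — POOLED over the four literals: `kappaSum_isoceles_shared_pool` gives the LHS of ★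
`kappaSum_isoceles_eq` from `n_BIG + n_SMALL − 2·n_bare` (the shared-κ configuration `N₁ = N₂ < N`: the axis pair is a κ-pair), with the two rank-one classes receiving the
SAME coefficient `2q^{s+2} − 2q² − 2q` (`pooled_coeff_P_eq`, `pooled_coeff_Pneg_eq` — the reason `X̃_{1+} = X̃_{1−}`), and `kappaSum_isoceles_opposite_pool` gives
`n_BIG − n_SMALL = 2q^{s+1}·(2E − P⁺ − P⁻)` (root and interior rows cancel).  (ii) **`kappaSum_isoceles_opposite_eq`** — the ISOCELES-B configuration `N₁ ≠ N₂` (`α` or `γ`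
isolated; design memo `DESIGN-a2C` §3, census «(3,5,3) mirror»): there the axis pair has OPPOSITE `κ` and so has the bare pair (equal classes ⇒ the bare literals cancel), so
`Σ_b κ_b n_b = κ_BIG·(n_BIG − n_SMALL)`, and `2q^{s+1}·(2S(E_{m+1}) − S(P⁺_m) − S(P⁻_m)) = q^{2m+3+s}·X̃(m+1)` is `q^s` times the `s = 0` case of ★ `kappaSum_isoceles_eq` (= ★ `kappaSum_equilateral_eq`) — the head's
normalisation again: `(N₁+N₂)∕2 = 2m+3+s`, `(N−1)∕2 = m+1` (the extra depth CANCELS).  Certificate: exact rational arithmetic `q ≤ 13`, `m, s ≤ 4` (seat folder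
`work/kappaiso/check_iso.py`).  [cite: Rogawski1990, §4.9 Prop. 4.9.1 (a) p. 55] [cite: Kottwitz1986, §3] -/

/-- `(Σ_{i<s} q^{i+1})·(q − 1) = q^{s+1} − q` over `ℚ`. [cite: Kottwitz1986, §3] -/
theorem geom_sum_succ_mul_sub_one_rat (q : ℚ) (s : ℕ) : (∑ i ∈ range s, q ^ (i + 1)) * (q - 1) = q ^ (s + 1) - q := by
  have h : (∑ i ∈ range s, q ^ (i + 1)) = q * ∑ i ∈ range s, q ^ i := by
    rw [Finset.mul_sum]
    exact Finset.sum_congr rfl (fun i _ => by ring)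
  rw [h, mul_assoc, geom_sum_mul]
  ring

/-- **Pooled coefficient of the root class `c_R`**: root + interior vertices of both axis literals (`A − 2q^s` vertices each, `(q−1)q` children) and the boundary rows
(`2q^s` vertices; BIG `((q−3)∕2)q`, SMALL `((q−1)∕2)q`) add up to `2q^{s+2} − 2q² − 2q` when `A = 1 + 2q(1 + q + ⋯ + q^{s−1})`. [cite: Kottwitz1986, §3] [cite: Rogawski1990, §4.9 p. 55] -/
theorem pooled_coeff_P_eq (q : ℚ) (s : ℕ) :
    2 * ((1 + 2 * q * ∑ i ∈ range s, q ^ i) - 2 * q ^ s) * ((q - 1) * q) + 2 * q ^ s * (((q - 3) / 2) * q + ((q - 1) / 2) * q) =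
      2 * q ^ (s + 2) - 2 * q ^ 2 - 2 * q := by
  have hS := geom_sum_mul q s
  linear_combination (4 * q ^ 2) * hS

/-- **Pooled coefficient of the opposite class `−c_R`**: boundary rows (BIG `((q−1)∕2)q`, SMALL `((q+1)∕2)q` on `2q^s` vertices) minus the two bare roots (`(q+1)q` each) give
the SAME `2q^{s+2} − 2q² − 2q`. [cite: Kottwitz1986, §3] [cite: Rogawski1990, §4.9 p. 55] -/
theorem pooled_coeff_Pneg_eq (q : ℚ) (s : ℕ) :
    2 * q ^ s * (((q - 1) / 2) * q + ((q + 1) / 2) * q) - 2 * ((q + 1) * q) = 2 * q ^ (s + 2) - 2 * q ^ 2 - 2 * q := by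
  ring

/-- **Pooled axis count**: `2A − 2 = 4q(1 + ⋯ + q^{s−1})` for `A = 1 + 2q(1 + ⋯ + q^{s−1})` (the two axis literals' `e₄`-mass minus the two bare roots'). [cite: Kottwitz1986, §3] -/
theorem pooled_coeff_axis_eq (q : ℚ) (s : ℕ) :
    2 * (1 + 2 * q * ∑ i ∈ range s, q ^ i) - 2 * 1 = 4 * q * ∑ i ∈ range s, q ^ i := by
  ring

/-- **POOLING, shared-κ configuration (`N₁ = N₂ < N`).**  For any scalars `e₄ E Pc Pm` (the `j`-components of `e₄`, `S(E_{m+1})`, `S(P^{c_R}_m)`, `S(P^{−c_R}_m)`) and the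
census multiplicities — axis count `A = 1 + 2q(1 + ⋯ + q^{s−1})`, boundary count `2q^s`, rows as in the section docstring, bare class `−c_R` — the κ-pooled total
`n_BIG + n_SMALL − 2·n_bare` is the left-hand side of ★ `kappaSum_isoceles_eq`: `4q^{s+1}·E + (2q^{s+2} − 2q² − 2q)·(Pc + Pm) + 4q(Σ_{i<s}qⁱ)·e₄`.
[cite: Kottwitz1986, §3] [cite: Rogawski1990, §4.9 Prop. 4.9.1 (a) p. 55] -/
theorem kappaSum_isoceles_shared_pool (q : ℚ) (s : ℕ) (A : ℚ) (hA : A = 1 + 2 * q * ∑ i ∈ range s, q ^ i) (e₄ E Pc Pm : ℚ) :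
    (A * e₄ + (A - 2 * q ^ s) * ((q - 1) * q) * Pc + 2 * q ^ s * (2 * q * E + ((q - 3) / 2) * q * Pc + ((q - 1) / 2) * q * Pm)) +
        (A * e₄ + (A - 2 * q ^ s) * ((q - 1) * q) * Pc + 2 * q ^ s * (((q - 1) / 2) * q * Pc + ((q + 1) / 2) * q * Pm)) -
        2 * (e₄ + (q + 1) * q * Pm) =
      4 * q ^ (s + 1) * E + (2 * q ^ (s + 2) - 2 * q ^ 2 - 2 * q) * (Pc + Pm) + 4 * q * (∑ i ∈ range s, q ^ i) * e₄ := by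
  have hP := pooled_coeff_P_eq q s
  subst hA
  linear_combination Pc * hP

/-- **POOLING, opposite-κ configuration (`N₁ ≠ N₂`).**  The difference of the two axis totals is `2q^{s+1}·(2E − Pc − Pm)` (root and interior rows cancel; only the boundary
rows differ). [cite: Kottwitz1986, §3] [cite: Rogawski1990, §4.9 Prop. 4.9.1 (a) p. 55] -/
theorem kappaSum_isoceles_opposite_pool (q : ℚ) (s : ℕ) (A e₄ E Pc Pm : ℚ) :
    (A * e₄ + (A - 2 * q ^ s) * ((q - 1) * q) * Pc + 2 * q ^ s * (2 * q * E + ((q - 3) / 2) * q * Pc + ((q - 1) / 2) * q * Pm)) -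
        (A * e₄ + (A - 2 * q ^ s) * ((q - 1) * q) * Pc + 2 * q ^ s * (((q - 1) / 2) * q * Pc + ((q + 1) / 2) * q * Pm)) =
      2 * q ^ (s + 1) * (2 * E - (Pc + Pm)) := by
  ring

/-- **THE ISOCELES-B κ-SUM IDENTITY (`N₁ ≠ N₂`: the common depth `N = 2m+3` is one of `N₁, N₂`, the other is `2m+3+2s`; `α` or `γ` isolated).**  The axis pair has
opposite `κ`, the bare pair cancels, `Σ_b κ_b n_b = ± (n_BIG − n_SMALL) = ± 2q^{s+1}·(2S(E_{m+1}) − S(P⁺_m) − S(P⁻_m))`, and for each stratum `j`: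
`2q^{s+1}·(2·S(E_{m+1})_j − (S(P⁺_m) + S(P⁻_m))_j) = q^{2m+3+s}·X̃_j(m+1)` — `q^s` times the `s = 0` case of ★ `kappaSum_isoceles_eq` (= ★ `kappaSum_equilateral_eq`): the head's `q^{(N₁+N₂)∕2}·X̃((N−1)∕2)` with
`(N₁+N₂)∕2 = 2m+3+s`, `(N−1)∕2 = m+1` (the extra depth cancels). [cite: Rogawski1990, §4.9 Prop. 4.9.1 (a) p. 55] [cite: Kottwitz1986, §3] -/
theorem kappaSum_isoceles_opposite_eq (q m s : ℕ) (hq : 2 ≤ q) (j : Fin 5) :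
    2 * (q : ℚ) ^ (s + 1) *
        (2 * (((![q ^ (3 * m + 3), q ^ (3 * m + 2), q.choose 2 * q ^ (2 * m) * ∑ i ∈ range m, q ^ i, q.choose 2 * q ^ (2 * m) * ∑ i ∈ range m, q ^ i,
              ∑ i ∈ range (m + 1), q ^ (2 * i) + ∑ i ∈ range m, q ^ (2 * m + 1 + i)] : Fin 5 → ℕ) j : ℕ) : ℚ) -
          (((![0, 0, q ^ (2 * m), q ^ (2 * m), 2 * ∑ i ∈ range m, q ^ (2 * i)] : Fin 5 → ℕ) j : ℕ) : ℚ)) =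
      (q : ℚ) ^ (2 * m + 3 + s) *
        (![4 * (q : ℚ) ^ (m + 1), 4 * (q : ℚ) ^ (m + 1 - 1), (2 * ((q : ℚ) ^ (m + 1) - q - 1)) / (q : ℚ) ^ 2, (2 * ((q : ℚ) ^ (m + 1) - q - 1)) / (q : ℚ) ^ 2,
            (4 * ((q : ℚ) ^ (m + 1) - 1)) / (((q : ℚ) - 1) * (q : ℚ) ^ 2)] : Fin 5 → ℚ) j := by
  -- `q^s` times the `s = 0` instance of ★ `kappaSum_isoceles_eq` (= ★ `kappaSum_equilateral_eq`)
  have h := kappaSum_isoceles_eq q m 0 hq j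
  have hn1 : m + 1 - 1 = m := by omega
  simp only [Finset.sum_range_zero, mul_zero, zero_mul, add_zero, zero_add, hn1] at h ⊢
  have hpow : (q : ℚ) ^ (2 * m + 3 + s) = (q : ℚ) ^ s * (q : ℚ) ^ (2 * m + 3) := by rw [← pow_add]; ring_nf
  rw [hpow]
  linear_combination ((q : ℚ) ^ s) * h

end Literature.NumberTheory.Rogawski1990
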